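import Literature.Probability.LatticeModels.LatticeGraph
import HarnessLib

/-!
# Vocabulary of line `slit-necklace`, part 5: boundary edges and the wall-follower tour of a lattice site set

Crux `SAWLeftRightFKG.FKGToTraversalBound` (stmt-CriticalPhenomena-1878), line `slit-necklace`, lead
prover-line-stmt-CriticalPhenomena-1878-c5-0; design `Cruxes/FKGToTraversalBound/Lines/slit-necklace-witness-design.md` (unit U1).

The planar witness `NecklaceWitnessFarU` routes a chord of the doubly-slit hung carrier along an OUTLINE ARC of the free
component `F` of the far tip: the wall-follower tour of the boundary of `F` (pixels of `F` on the left, pixels of the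
complement on the right).  This file is the shared, purely combinatorial vocabulary of that construction on `ℤ²`
(`Site 2`): the four directions `ODir` with their unit vectors and quarter turns, boundary edges `IsBEdge A (x, d)`
(`x ∈ A`, `x + d ∉ A`), the wall-follower successor `bnext A` and its iterate `btour A e₀ n`, the outline site and the
contact site of a boundary edge.  Small closed API (the successor of a boundary edge is a boundary edge; the three
cases of a step).  Registered glue: `bnext_isBEdge`.

Definitions and closed lemmas only; no literature fact; nothing restates the crux.  [folklore: "wall follower" /
boundary tracing of a polyomino]
-/

noncomputable section

open Literature.Probability.LatticeModels

namespace Summit.CriticalPhenomena.SAWScalingLimit.Theorems.FKGToTraversalBound.SlitNecklace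

/-- The four lattice directions of `ℤ²`, counter-clockwise from east: `0 = E`, `1 = N`, `2 = W`, `3 = S`. [folklore] -/
abbrev ODir : Type := Fin 4

namespace ODir

/-- The unit vector of a direction. [folklore] -/
def vec : ODir → Site 2
  | 0 => Pi.single 0 1
  | 1 => Pi.single 1 1
  | 2 => -Pi.single 0 1
  | 3 => -Pi.single 1 1

/-- Quarter turn counter-clockwise (`E ↦ N ↦ W ↦ S ↦ E`). [folklore] -/
def ccw (d : ODir) : ODir := d + 1

/-- Quarter turn clockwise (`E ↦ S ↦ W ↦ N ↦ E`). [folklore] -/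
def cw (d : ODir) : ODir := d + 3

/-- Half turn. [folklore] -/
def rev (d : ODir) : ODir := d + 2

/-- `ccw` undoes `cw`. [folklore] -/
@[simp] theorem ccw_cw (d : ODir) : d.cw.ccw = d := by
  fin_cases d <;> rfl

/-- `cw` undoes `ccw`. [folklore] -/
@[simp] theorem cw_ccw (d : ODir) : d.ccw.cw = d := by
  fin_cases d <;> rfl

/-- `vec (rev d) = - vec d`. [folklore] -/
@[simp] theorem vec_rev (d : ODir) : d.rev.vec = -d.vec := by
  fin_cases d <;> simp [rev, vec]

/-- `vec (cw d) = - vec (ccw d)`. [folklore] -/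
theorem vec_cw (d : ODir) : d.cw.vec = -d.ccw.vec := by
  fin_cases d <;> simp [cw, ccw, vec]

/-- A step in a lattice direction is an edge of `ℤ²`. [folklore] -/
theorem adj_add_vec (x : Site 2) (d : ODir) : (zdGraph 2).Adj x (x + d.vec) := by
  rw [zdGraph_adj_iff]
  fin_cases d
  · exact ⟨0, Or.inl rfl⟩
  · exact ⟨1, Or.inl rfl⟩
  · exact ⟨0, Or.inr (by simp [vec])⟩
  · exact ⟨1, Or.inr (by simp [vec])⟩

/-- Every edge of `ℤ²` is a step in some direction. [folklore] -/
theorem exists_eq_add_vec_of_adj {x y : Site 2} (h : (zdGraph 2).Adj x y) : ∃ d : ODir, y = x + d.vec := by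
  obtain ⟨i, h | h⟩ := (zdGraph_adj_iff x y).1 h
  · fin_cases i
    · exact ⟨0, h⟩
    · exact ⟨1, h⟩
  · fin_cases i
    · exact ⟨2, by rw [h]; simp [vec]⟩
    · exact ⟨3, by rw [h]; simp [vec]⟩

end ODir

/-- **Boundary edge** of the site set `A`: the site `x ∈ A` together with a direction `d` whose neighbour `x + d` lies
OUTSIDE `A`.  Geometrically: the dual edge between the pixel of `x` and the pixel of `x + d`; it is traversed with `A`
on the LEFT, i.e. in direction `d.ccw`, from the corner `x + (d + d.cw)/2` to the corner `x + (d + d.ccw)/2`. [folklore] -/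
def IsBEdge (A : Set (Site 2)) (e : Site 2 × ODir) : Prop :=
  e.1 ∈ A ∧ e.1 + e.2.vec ∉ A

/-- The OUTLINE site of a boundary edge (its `A`-pixel). [folklore] -/
def bsite (e : Site 2 × ODir) : Site 2 := e.1

/-- The CONTACT site of a boundary edge (its outside pixel, `4`-adjacent to the outline site). [folklore] -/
def bcontact (e : Site 2 × ODir) : Site 2 := e.1 + e.2.vec

open Classical in
/-- **Wall-follower successor** (keep `A` on the left, the outside on the right).  At the far corner of the boundary
edge `(x, d)` look at the pixel AHEAD `a = x + d.ccw` and the pixel AHEAD-RIGHT `o' = x + d + d.ccw`: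
* `a ∉ A`: convex corner of `A` — turn left around `x`: next edge `(x, d.ccw)`;
* `a ∈ A`, `o' ∉ A`: straight on: next edge `(a, d)`;
* `a ∈ A`, `o' ∈ A`: reflex corner — turn right: next edge `(o', d.cw)` (its outside pixel is `x + d` again).
(A "pinch" — `a ∉ A`, `o' ∈ A` — is treated as impassable: the tour turns left; for a `4`-connected `A` with `4`-connected
complement pinches do not occur.) [folklore] -/
def bnext (A : Set (Site 2)) (e : Site 2 × ODir) : Site 2 × ODir :=
  if e.1 + e.2.ccw.vec ∉ A then (e.1, e.2.ccw)
  else if e.1 + e.2.vec + e.2.ccw.vec ∉ A then (e.1 + e.2.ccw.vec, e.2)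
  else (e.1 + e.2.vec + e.2.ccw.vec, e.2.cw)

/-- The wall-follower TOUR from the boundary edge `e₀`: `n`-fold successor. [folklore] -/
def btour (A : Set (Site 2)) (e₀ : Site 2 × ODir) (n : ℕ) : Site 2 × ODir :=
  (bnext A)^[n] e₀

/-- The tour starts at `e₀`. [folklore] -/
@[simp] theorem btour_zero (A : Set (Site 2)) (e₀ : Site 2 × ODir) : btour A e₀ 0 = e₀ := rfl

/-- One more step of the tour. [folklore] -/
theorem btour_succ (A : Set (Site 2)) (e₀ : Site 2 × ODir) (n : ℕ) :
    btour A e₀ (n + 1) = bnext A (btour A e₀ n) := by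
  simp only [btour, Function.iterate_succ_apply']

/-- **The three cases of a step**, as a disjunction usable without unfolding `bnext`. [folklore] -/
theorem bnext_cases (A : Set (Site 2)) (x : Site 2) (d : ODir) :
    (x + d.ccw.vec ∉ A ∧ bnext A (x, d) = (x, d.ccw)) ∨
    (x + d.ccw.vec ∈ A ∧ x + d.vec + d.ccw.vec ∉ A ∧ bnext A (x, d) = (x + d.ccw.vec, d)) ∨
    (x + d.ccw.vec ∈ A ∧ x + d.vec + d.ccw.vec ∈ A ∧ bnext A (x, d) = (x + d.vec + d.ccw.vec, d.cw)) := by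
  classical
  by_cases ha : x + d.ccw.vec ∈ A
  · by_cases ho : x + d.vec + d.ccw.vec ∈ A
    · exact Or.inr (Or.inr ⟨ha, ho, by simp [bnext, ha, ho]⟩)
    · exact Or.inr (Or.inl ⟨ha, ho, by simp [bnext, ha, ho]⟩)
  · exact Or.inl ⟨ha, by simp [bnext, ha]⟩

/-- **Registered glue: the successor of a boundary edge is a boundary edge.** [folklore] -/
theorem bnext_isBEdge : ∀ (A : Set (Site 2)) (e : Site 2 × ODir), IsBEdge A e → IsBEdge A (bnext A e) := by
  intro A e he
  obtain ⟨x, d⟩ := e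
  obtain ⟨hx, hxd⟩ := he
  rcases bnext_cases A x d with ⟨ha, h⟩ | ⟨ha, ho, h⟩ | ⟨ha, ho, h⟩
  · rw [h]; exact ⟨hx, ha⟩
  · rw [h]; refine ⟨ha, ?_⟩
    simpa [add_assoc, add_comm (d.ccw.vec)] using ho
  · rw [h]; refine ⟨ho, ?_⟩
    have : x + d.vec + d.ccw.vec + d.cw.vec = x + d.vec := by
      rw [ODir.vec_cw]; abel
    simpa [this] using hxd

/-- Every tour edge is a boundary edge. [folklore] -/
theorem btour_isBEdge (A : Set (Site 2)) {e₀ : Site 2 × ODir} (h₀ : IsBEdge A e₀) (n : ℕ) :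
    IsBEdge A (btour A e₀ n) := by
  induction n with
  | zero => simpa using h₀
  | succ n ih => rw [btour_succ]; exact bnext_isBEdge A _ ih

/-- The contact of a boundary edge is outside `A` and `4`-adjacent to its outline site. [folklore] -/
theorem bcontact_spec (A : Set (Site 2)) {e : Site 2 × ODir} (he : IsBEdge A e) :
    bsite e ∈ A ∧ bcontact e ∉ A ∧ (zdGraph 2).Adj (bsite e) (bcontact e) :=
  ⟨he.1, he.2, ODir.adj_add_vec e.1 e.2⟩

/-- A site of `A` with a neighbour outside `A` is the outline site of a boundary edge. [folklore] -/
theorem exists_isBEdge_of_adj (A : Set (Site 2)) {x y : Site 2} (hx : x ∈ A) (hy : y ∉ A)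
    (hxy : (zdGraph 2).Adj x y) : ∃ d : ODir, IsBEdge A (x, d) ∧ bcontact (x, d) = y := by
  obtain ⟨d, rfl⟩ := ODir.exists_eq_add_vec_of_adj hxy
  exact ⟨d, ⟨hx, hy⟩, rfl⟩

end Summit.CriticalPhenomena.SAWScalingLimit.Theorems.FKGToTraversalBound.SlitNecklace

end
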